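import Literature.Computability.QuantumComplexity.ExactBosonSamplingHardness
import Literature.Computability.Complexity.OracleCompositionMachine
import HarnessLib

/-!
# Valiant: the permanent of a `0/1` matrix is `#P`-hard (named fact)

L. G. Valiant, *The complexity of computing the permanent*, Theoret. Comput. Sci. 8 (1979)
189–201, Theorem 1: "the problem of computing the permanent of a `(0,1)`-matrix is
`#P`-complete" — completeness under polynomial-time *Turing* (oracle) reductions (the reduction
from `#SAT` goes through integer matrices, then matrices mod a product of small primes, then
`(0,1)`-matrices, recovering the answer by arithmetic on several oracle answers; §3–§4). This is
Aaronson–Arkhipov's Theorem 4.2 (*The computational complexity of linear optics*, Theory of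
Computing 9 (2013), p. 175), the input of their Theorem 4.3.

Vendored as a named fact (no proof in the tree: the gadget construction is a substantial
formalisation of its own; a simpler proof is Ben-Dor–Halevi, *Zero-one permanent is
`#P`-complete, a simpler proof*, ISTCS 1993), in the tree's model of `#P`-hardness
(`IsSharpPHardFun`, `Counting.lean`: every `f ∈ #P` is computable in `FP` with oracle access to
the function, answers in binary):

* `per01Fn` — the function "permanent of the `0/1` matrix coded by the input" on bit strings
  (square integer matrices coded by `encodingIntMatrix` of `ExactBosonSamplingHardness.lean`;
  inputs that do not decode to a `0/1` matrix are sent to `0`);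
* `permanent01_isSharpPHardFun : Prop` — **Valiant's theorem**: `IsSharpPHardFun per01Fn`.

With the composition theorem `OracleAlg.PRel_subset_PRel_of_mem_FPRel`
(`OracleCompositionMachine.lean`: `f ∈ FP^O ⟹ P^f ⊆ P^O`) a `#P`-hard oracle decides all of
`P^{#P}` (`PSharpP_subset_PRel_of_isSharpPHard`, `PSharpP_subset_PRel_ofFun_of_isSharpPHardFun`),
so the fact gives `P^{#P} ⊆ P^{per01Fn}` (`PSharpP_subset_PRel_per01Fn`), the first inclusion of
the chain `P^{#P} ⊆ P^{Per} ⊆ BPP^{O}` behind `PSharpP_subset_BPPRel_of_perSqRandOracleSolves`.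

## References

* L. G. Valiant, *The complexity of computing the permanent*, Theoret. Comput. Sci. 8 (1979)
  189–201, Thm. 1. doi:10.1016/0304-3975(79)90044-6
* S. Aaronson, A. Arkhipov, *The computational complexity of linear optics*, Theory of
  Computing 9 (2013), Thm. 4.2 (p. 175).
* A. Ben-Dor, S. Halevi, *Zero-one permanent is #P-complete, a simpler proof*, Proc. 2nd Israel
  Symposium on Theory of Computing and Systems (1993), 108–117.
-/

namespace Literature.Computability.QuantumComplexity

open _root_.Computability Complexity Matrix

/-- `0/1` test for a coded square integer matrix. [folklore] -/
def isZeroOneEntries : (Σ n : ℕ, Fin n → Fin n → ℤ) → Bool :=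
  fun M => decide (∀ i j, M.2 i j = 0 ∨ M.2 i j = 1)

/-- **The `0/1` permanent as a function on bit strings**: decode the input as a square integer
matrix (`encodingIntMatrix`); if it is a `0/1` matrix return its permanent (a natural number),
otherwise `0`. (Valiant 1979, Thm. 1: the function PERMANENT restricted to `(0,1)`-matrices;
Aaronson–Arkhipov Thm. 4.2.) [cite: Valiant1979, Thm. 1] -/
noncomputable def per01Fn (w : List Bool) : ℕ :=
  match encodingIntMatrix.decode w with
  | none => 0
  | some M => if isZeroOneEntries M then ((Matrix.of M.2).permanent).toNat else 0

/-- `per01Fn` on the code of a `0/1` matrix is its permanent. [cite: Valiant1979, Thm. 1] -/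
theorem per01Fn_encode {n : ℕ} (X : Fin n → Fin n → ℤ) (hX : ∀ i j, X i j = 0 ∨ X i j = 1) :
    per01Fn (encodingIntMatrix.encode ⟨n, X⟩) = ((Matrix.of X).permanent).toNat := by
  simp only [per01Fn, encodingIntMatrix.decode_encode, isZeroOneEntries]
  rw [if_pos (by simpa using hX)]

/-- **Valiant's theorem (named fact): the permanent of `0/1` matrices is `#P`-hard** under
polynomial-time Turing reductions — every `#P` function is computable in polynomial time with
oracle access to `per01Fn` (`IsSharpPHardFun`, answers in binary). Valiant 1979, Thm. 1 ("the
permanent of (0,1)-matrices is #P-complete"); Aaronson–Arkhipov 2013, Thm. 4.2. Stated as a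
`Prop`; a discharge is the formalisation of Valiant's (or Ben-Dor–Halevi's) gadget reduction
together with its polynomial-time oracle machine. [cite: Valiant1979, Thm. 1] -/
def permanent01_isSharpPHardFun : Prop :=
  IsSharpPHardFun per01Fn

/-! ### `#P`-hard oracles decide `P^{#P}` -/

/-- **A `#P`-hard oracle decides all of `P^{#P}`**: `IsSharpPHard O → P^{#P} ⊆ P^O` — every
`f ∈ #P` is in `FP^O` (hardness), so `P^f ⊆ P^O` (`OracleAlg.PRel_subset_PRel_of_mem_FPRel`,
`OracleCompositionMachine.lean`), and `P^{#P} = ⋃_{f ∈ #P} P^f`. [Arora–Barak 2009, Def. 17.5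
with §17.2] [cite: AroraBarak2009, Def. 17.5] -/
theorem PSharpP_subset_PRel_of_isSharpPHard {O : Oracle} (hO : IsSharpPHard O) :
    PSharpP ⊆ PRel O := by
  intro L hL
  obtain ⟨f, hf, hLf⟩ := Set.mem_iUnion₂.1 hL
  exact OracleAlg.PRel_subset_PRel_of_mem_FPRel (hO f hf) hLf

/-- Hence **`P^{#P} ⊆ P^{h}` for every `#P`-hard function `h`**. [Arora–Barak 2009, Def. 17.5] [cite: AroraBarak2009, Def. 17.5] -/
theorem PSharpP_subset_PRel_ofFun_of_isSharpPHardFun {h : List Bool → ℕ}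
    (hh : IsSharpPHardFun h) : PSharpP ⊆ PRel (Oracle.ofFun h) :=
  PSharpP_subset_PRel_of_isSharpPHard hh

/-- **`P^{#P} ⊆ P^{Per}`** for the `0/1` permanent, from Valiant's theorem (AA13 Thm. 4.2: "it
suffices to compute `Per(X)` for `0/1` matrices"). [cite: AaronsonArkhipovToC2013, Thm. 4.2 (p. 175)] -/
theorem PSharpP_subset_PRel_per01Fn (hVal : permanent01_isSharpPHardFun) :
    PSharpP ⊆ PRel (Oracle.ofFun per01Fn) :=
  PSharpP_subset_PRel_ofFun_of_isSharpPHardFun hVal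

end Literature.Computability.QuantumComplexity
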